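import Mathlib
import HarnessLib
import Summits.Ventures.LatticeQCDFlow.Exactness.NCMCGeneralSpaceRestartChainGammaCoverage

/-!
# Every bounded record statistic along the restart chain: the printed Γ-method interval `ḡ_n ± z √(Γ̂_n(0) · 2 τ̂_{n,W_n}/n)` covers `E_F g` with asymptotically nominal probability from EVERY initial record law

HONEST FRAMING: exact (Metropolis-corrected) sampling algorithms for lattice gauge theory;
figures of merit are autocorrelation/cost numbers at stated couplings and volumes; no
continuum-physics claim.

Venture `LatticeQCDFlow` (cell pub-lqcd), topic `Exactness`; FANOUT row 13 (`eng-snf`, GEN-22).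
NEW WORK of the cell, not a published result; no definition is introduced; nothing is cited as a
fact.  Besides `dF` the engine prints per-launch DIAGNOSTICS averaged over the record stream — the
switch acceptance `min(1, e^{−(W−c)})`, the mean work, the mean dissipation, end-point observables —
each with a Γ-method error bar computed from that statistic's own series.  Along CORRELATED launches
(the restart chain `R = (κF ∘ₖ K).comap s`, one-step minorised by `κF ∘ₘ m`, GEN-18) GEN-20's
interval theorem applies verbatim to every bounded measurable record observable
(`CrooksPair.tendsto_measure_mean_mem_gammaInterval_restartChain`, §3 of
`NCMCGeneralSpaceRestartChainGammaCoverage`); this file records the every-start form and the engine's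
switch-acceptance instance (the Jarzynski `dF` itself, which needs the `−log`, is §2 of that file; the
positivity hypothesis `σ²_g > 0` is discharged for stochastic protocols by
`NCMCGeneralSpaceRestartChainVarianceFloor` and for start observables with a reversible level sampler
by `NCMCGeneralSpaceRestartChainStartObservable`).

## Content (Crooks pair, `Z₀ ≠ 0`; `K` Markov, `ν₀`-invariant, `m ≤ K(z, ·)` ∀ `z`, `m(Ω) ≠ 0`;
## `g` measurable with `|g| ≤ C` and Green–Kubo variance `σ²_g > 0` along `R`; windows `W_n → ∞`,
## `W_n³/n → 0`; `z > 0`)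

* **`CrooksPair.tendsto_measure_mean_mem_gammaInterval_restartChain_everyStart`** — first record
  launched from ANY configuration `x`:
  `P{ |ḡ_n − E_F g| ≤ z √(Γ̂_n(0) · 2 τ̂_{n,W_n} / n) } → gaussianReal 0 1 (Icc (−z) z)`.
* **`CrooksPair.tendsto_measure_meanAccept_mem_gammaInterval_restartChain`** — the instance for the
  switch acceptance statistic `min(1, e^{−(W − c)})` (mean `a_F(c) = ∫ min(1, e^{−(W−c)}) dP_F`).
* **`CrooksPair.tendsto_measure_meanWork_mem_gammaInterval_restartChain`** — the instance for the
  mean work `W̄_n` under bounded work `|W| ≤ B` (mean `⟨W⟩_F = ∫ W dP_F`, the dissipation bound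
  `ΔF ≤ ⟨W⟩_F` being what the engine prints it for).

NOT CLAIMED: `σ²_g > 0` (assumed; see the two files above); unbounded work; anything numerical.
-/

namespace Summit.Ventures.LatticeQCDFlow.Exactness.GeneralNCMC

open MeasureTheory ProbabilityTheory Set Filter Finset
open scoped ENNReal Topology

variable {Ω E : Type*} [MeasurableSpace Ω] [MeasurableSpace E]

namespace CrooksPair

variable {ν₀ ν₁ : Measure Ω} [IsFiniteMeasure ν₀] [IsFiniteMeasure ν₁] {κF κR : Kernel Ω E}
  [IsMarkovKernel κF] [IsMarkovKernel κR] {s e : E → Ω} {W : E → ℝ}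

omit [IsFiniteMeasure ν₁] [IsMarkovKernel κR] in
/-- **… from EVERY initial configuration** (first record launched from ANY `x`, then `K` between
launches). -/
theorem tendsto_measure_mean_mem_gammaInterval_restartChain_everyStart (K : Kernel Ω Ω)
    [IsMarkovKernel K] (h0 : ν₀ univ ≠ 0) (hK : Kernel.Invariant K ν₀)
    (h : CrooksPair ν₀ ν₁ κF κR s e W) {m : Measure Ω} [IsFiniteMeasure m] (hm0 : m univ ≠ 0)
    (hmin : ∀ z, m ≤ K z) {g : E → ℝ} (hg : Measurable g) {C : ℝ} (hC : ∀ ω, |g ω| ≤ C)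
    (hσ : 0 < Scoring.autocov ((κF ∘ₖ K).comap s h.measurable_s) (fwdPathLaw ν₀ κF)
          (fun ω => g ω - ∫ z, g z ∂(fwdPathLaw ν₀ κF)) 0
        + 2 * ∑' t, Scoring.autocov ((κF ∘ₖ K).comap s h.measurable_s) (fwdPathLaw ν₀ κF)
          (fun ω => g ω - ∫ z, g z ∂(fwdPathLaw ν₀ κF)) (t + 1))
    {Wn : ℕ → ℕ} (hW : Tendsto Wn atTop atTop)
    (hW3 : Tendsto (fun n => (Wn n : ℝ) ^ 3 / n) atTop (𝓝 0)) {z : ℝ} (hz : 0 < z) (x : Ω)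
    [IsProbabilityMeasure (Kernel.trajMeasure (X := fun _ : ℕ => E) (κF x)
        (fun n : ℕ => ((κF ∘ₖ K).comap s h.measurable_s).comap
          (fun hh : (j : ↥(Finset.Iic n)) → E => hh ⟨n, Finset.mem_Iic.2 le_rfl⟩)
          (measurable_pi_apply _)))] :
    Tendsto (fun n : ℕ => (Kernel.trajMeasure (X := fun _ : ℕ => E) (κF x)
        (fun n : ℕ => ((κF ∘ₖ K).comap s h.measurable_s).comap
          (fun hh : (j : ↥(Finset.Iic n)) → E => hh ⟨n, Finset.mem_Iic.2 le_rfl⟩)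
          (measurable_pi_apply _)))
        {ω : ℕ → E | |(∑ i ∈ range n, g (ω i)) / n - ∫ z, g z ∂(fwdPathLaw ν₀ κF)|
          ≤ z * Real.sqrt (Scoring.gammaHat (fun i => g (ω i)) n 0
            * (2 * Scoring.tauIntWindow (Scoring.rhoHat (fun i => g (ω i)) n) (Wn n)) / n)})
      atTop (𝓝 (gaussianReal 0 1 (Icc (-z) z))) :=
  h.tendsto_measure_mean_mem_gammaInterval_restartChain K h0 hK hm0 hmin hg hC hσ hW hW3 hz (κF x)

omit [IsFiniteMeasure ν₁] [IsMarkovKernel κR] in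
/-- **The switch acceptance statistic**: `g = min(1, e^{−(W − c)})` is measurable with `|g| ≤ 1`, so
along the restart chain the printed interval for the mean acceptance `a_F(c) = ∫ min(1, e^{−(W−c)}) dP_F`
is asymptotically exact from every initial record law (positive Green–Kubo variance assumed). -/
theorem tendsto_measure_meanAccept_mem_gammaInterval_restartChain (K : Kernel Ω Ω) [IsMarkovKernel K]
    (h0 : ν₀ univ ≠ 0) (hK : Kernel.Invariant K ν₀) (h : CrooksPair ν₀ ν₁ κF κR s e W)
    {m : Measure Ω} [IsFiniteMeasure m] (hm0 : m univ ≠ 0) (hmin : ∀ z, m ≤ K z) (c : ℝ)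
    (hσ : 0 < Scoring.autocov ((κF ∘ₖ K).comap s h.measurable_s) (fwdPathLaw ν₀ κF)
          (fun ω => min 1 (Real.exp (-(W ω - c)))
            - ∫ z, min 1 (Real.exp (-(W z - c))) ∂(fwdPathLaw ν₀ κF)) 0
        + 2 * ∑' t, Scoring.autocov ((κF ∘ₖ K).comap s h.measurable_s) (fwdPathLaw ν₀ κF)
          (fun ω => min 1 (Real.exp (-(W ω - c)))
            - ∫ z, min 1 (Real.exp (-(W z - c))) ∂(fwdPathLaw ν₀ κF)) (t + 1))
    {Wn : ℕ → ℕ} (hW : Tendsto Wn atTop atTop)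
    (hW3 : Tendsto (fun n => (Wn n : ℝ) ^ 3 / n) atTop (𝓝 0)) {z : ℝ} (hz : 0 < z)
    (μ₀ : Measure E) [IsProbabilityMeasure μ₀]
    [IsProbabilityMeasure (Kernel.trajMeasure (X := fun _ : ℕ => E) μ₀
        (fun n : ℕ => ((κF ∘ₖ K).comap s h.measurable_s).comap
          (fun hh : (j : ↥(Finset.Iic n)) → E => hh ⟨n, Finset.mem_Iic.2 le_rfl⟩)
          (measurable_pi_apply _)))] :
    Tendsto (fun n : ℕ => (Kernel.trajMeasure (X := fun _ : ℕ => E) μ₀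
        (fun n : ℕ => ((κF ∘ₖ K).comap s h.measurable_s).comap
          (fun hh : (j : ↥(Finset.Iic n)) → E => hh ⟨n, Finset.mem_Iic.2 le_rfl⟩)
          (measurable_pi_apply _)))
        {ω : ℕ → E | |(∑ i ∈ range n, min 1 (Real.exp (-(W (ω i) - c)))) / n
            - ∫ z, min 1 (Real.exp (-(W z - c))) ∂(fwdPathLaw ν₀ κF)|
          ≤ z * Real.sqrt (Scoring.gammaHat (fun i => min 1 (Real.exp (-(W (ω i) - c)))) n 0
            * (2 * Scoring.tauIntWindow
              (Scoring.rhoHat (fun i => min 1 (Real.exp (-(W (ω i) - c)))) n) (Wn n)) / n)})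
      atTop (𝓝 (gaussianReal 0 1 (Icc (-z) z))) := by
  have hgm : Measurable fun ω => min 1 (Real.exp (-(W ω - c))) :=
    measurable_const.min (Real.measurable_exp.comp (h.measurable_W.sub measurable_const).neg)
  have hgC : ∀ ω, |min 1 (Real.exp (-(W ω - c)))| ≤ 1 := fun ω => by
    rw [abs_of_nonneg (le_min zero_le_one (Real.exp_pos _).le)]
    exact min_le_left _ _
  exact h.tendsto_measure_mean_mem_gammaInterval_restartChain K h0 hK hm0 hmin hgm hgC hσ hW hW3 hz μ₀

omit [IsFiniteMeasure ν₁] [IsMarkovKernel κR] in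
/-- **The mean work** (bounded work `|W| ≤ B`): along the restart chain the printed interval
`W̄_n ± z √(Γ̂_n(0) · 2 τ̂_{n,W_n} / n)` for `⟨W⟩_F = ∫ W dP_F` is asymptotically exact from every
initial record law (positive Green–Kubo variance of `W` along `R` assumed). -/
theorem tendsto_measure_meanWork_mem_gammaInterval_restartChain (K : Kernel Ω Ω) [IsMarkovKernel K]
    (h0 : ν₀ univ ≠ 0) (hK : Kernel.Invariant K ν₀) (h : CrooksPair ν₀ ν₁ κF κR s e W)
    {m : Measure Ω} [IsFiniteMeasure m] (hm0 : m univ ≠ 0) (hmin : ∀ z, m ≤ K z)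
    {B : ℝ} (hB : ∀ ω, |W ω| ≤ B)
    (hσ : 0 < Scoring.autocov ((κF ∘ₖ K).comap s h.measurable_s) (fwdPathLaw ν₀ κF)
          (fun ω => W ω - ∫ z, W z ∂(fwdPathLaw ν₀ κF)) 0
        + 2 * ∑' t, Scoring.autocov ((κF ∘ₖ K).comap s h.measurable_s) (fwdPathLaw ν₀ κF)
          (fun ω => W ω - ∫ z, W z ∂(fwdPathLaw ν₀ κF)) (t + 1))
    {Wn : ℕ → ℕ} (hW : Tendsto Wn atTop atTop)
    (hW3 : Tendsto (fun n => (Wn n : ℝ) ^ 3 / n) atTop (𝓝 0)) {z : ℝ} (hz : 0 < z)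
    (μ₀ : Measure E) [IsProbabilityMeasure μ₀]
    [IsProbabilityMeasure (Kernel.trajMeasure (X := fun _ : ℕ => E) μ₀
        (fun n : ℕ => ((κF ∘ₖ K).comap s h.measurable_s).comap
          (fun hh : (j : ↥(Finset.Iic n)) → E => hh ⟨n, Finset.mem_Iic.2 le_rfl⟩)
          (measurable_pi_apply _)))] :
    Tendsto (fun n : ℕ => (Kernel.trajMeasure (X := fun _ : ℕ => E) μ₀
        (fun n : ℕ => ((κF ∘ₖ K).comap s h.measurable_s).comap
          (fun hh : (j : ↥(Finset.Iic n)) → E => hh ⟨n, Finset.mem_Iic.2 le_rfl⟩)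
          (measurable_pi_apply _)))
        {ω : ℕ → E | |(∑ i ∈ range n, W (ω i)) / n - ∫ z, W z ∂(fwdPathLaw ν₀ κF)|
          ≤ z * Real.sqrt (Scoring.gammaHat (fun i => W (ω i)) n 0
            * (2 * Scoring.tauIntWindow (Scoring.rhoHat (fun i => W (ω i)) n) (Wn n)) / n)})
      atTop (𝓝 (gaussianReal 0 1 (Icc (-z) z))) :=
  h.tendsto_measure_mean_mem_gammaInterval_restartChain K h0 hK hm0 hmin h.measurable_W hB hσ hW hW3 hz μ₀

end CrooksPair

end Summit.Ventures.LatticeQCDFlow.Exactness.GeneralNCMC
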